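import Literature.MathematicalPhysics.QuantumLattice.EmeryThreeBandPhysClusterTrialCap
import HarnessLib

/-!
# The three-band cluster trial STATE on the physical sites, packaged for the cap door: a member of `emeryStates ρ` whose fifteen cell energies
# (`emeryViews θ₀` and the fourteen `emeryDirections`) are open-cluster traces of ONE density matrix on `Cu_{ab}O_{2ab}`

Topic `Literature/MathematicalPhysics/QuantumLattice` (family `hubbard`; crew hubbard-fast S2 (iv) «three-band Emery boxes»). The Downfold cap door
`S2SeamEmeryCaps.holdsOn_emeryEnergyCap` (hubbard-downfold-mod-4) is stated for a STATE `ω₀ ∈ emeryStates ρ` through its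
`trialCap ω₀ θ₀ θ = cellEnergy (emeryViews θ₀) 1 ω₀ + Σ_a (θ_a − θ₀_a)·cellEnergy (emeryDirections a) 1 ω₀`. `EmeryThreeBandPhysClusterTrialCap` gives the
resulting INEQUALITY directly; this file gives the STATE and its numbers, so the door can be instantiated verbatim:

* `emeryClusterTrialState m ρ_S …` := `perRectTrialState liebPeriods m (vacExtend ρ_S)` (the `(2ℤ)²`-average of `⊗_v (ρ_S ⊗ |∅⟩⟨∅|_dummies)`);
* `emeryClusterTrialState_mem_emeryStates` (`Re tr(N_S ρ_S) = 4·|Cell m|·ρ`);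
* **`cellEnergy_emeryViews_emeryClusterTrialState`** `= |block|⁻¹ · Re tr(H^θ_S ρ_S)`, **`cellEnergy_emeryDirections_emeryClusterTrialState`**
  `= |block|⁻¹ · Re tr(D_{a,S} ρ_S)` (`S = emeryPhysSites m`, `|block| = 4|Cell m|`);
* **`trialCap_emeryClusterTrialState_eq`**: `e_{M(θ₀)}(ω̃) + Σ_a (θ_a − θ₀_a) e_{D_a}(ω̃) = |block|⁻¹ Σ_a θ_a Re tr(D_{a,S} ρ_S)` for EVERY anchor `θ₀` —
  the right-hand side of mod-4's `trialCap`, as fourteen cluster traces.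

Everything is PROVED (0 sorry); definition with body: `emeryClusterTrialState`. HONEST SCOPE: packaging; no number.

## Tree / Mathlib search

REUSED: `emeryPhysSites(_subset)`, `emeryInteraction/emeryAtoms_apply_eq_zero_of_not_subset_phys`, `dummyPoint_mem_sdiff` (`EmeryThreeBandPhysClusterTrialCap`);
`perRectTrialState_liebPeriods_mem_emeryStates`, `cellEnergy_emeryViews/emeryDirections_perRectTrialState`, `localHamiltonian_emeryInteraction`
(`EmeryThreeBandClusterTrialCap`); `vacExtend`, `parityAut/posSemidef/trace_vacExtend`, `trace_nAt_compl_mul_vacExtend`, `trace_totalNumber_mul_vacExtend`,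
`trace_localHamiltonian_mul_vacExtend` (`FermionVacuumExtension`).

## References

* D. Ruelle, *Statistical Mechanics: Rigorous Results* (1969), §3.3. [cite: Ruelle1969, §3.3]
* H. Araki, H. Moriya, Rev. Math. Phys. 15 (2003) 93, §11.1 Thm. 11.2. [cite: ArakiMoriya2003, §11.1 Theorem 11.2]
* T. Koma, H. Tasaki, J. Stat. Phys. 76 (1994) 745, §1 (trial caps affine in the couplings). [cite: KomaTasaki1994, §1]
-/

noncomputable section

open scoped ComplexOrder BigOperators
open Finset

namespace Literature.MathematicalPhysics.QuantumLattice

open Matrix HubbardWave0 Literature.Probability.LatticeModels ThermodynamicLimit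

namespace InfVolFermionState

section TrialState

variable (m : Fin 2 → ℕ) (ρS : FermionOp (emeryPhysSites m)) (hev : parityAut ρS = ρS) (hpsd : ρS.PosSemidef) (htr : ρS.trace = 1)

/-- **The three-band cluster trial state** built from a density matrix on the physical sites `Cu_{ab}O_{2ab}` of the block: the `(2ℤ)²`-average of
the tiling state of `ρ_S ⊗ |∅⟩⟨∅|_dummies`. [cite: ArakiMoriya2003, §11.1 Theorem 11.2] -/
def emeryClusterTrialState : InfVolFermionState 2 :=
  perRectTrialState liebPeriods m (vacExtend (emeryPhysSites_subset m) ρS) (parityAut_vacExtend _ hev) (posSemidef_vacExtend _ hpsd)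
    (by rw [trace_vacExtend, htr])

/-- **Membership**: with `Re tr(N_S ρ_S) = 4·|Cell m|·ρ` the cluster trial state lies in `emeryStates ρ`. [cite: ArakiMoriya2003, §11.1 Theorem 11.2] -/
theorem emeryClusterTrialState_mem_emeryStates {ρ : ℝ}
    (hN : ((totalNumber : FermionOp (emeryPhysSites m)) * ρS).trace.re = 4 * Fintype.card (Cell m) * ρ) :
    emeryClusterTrialState m ρS hev hpsd htr ∈ emeryStates ρ :=
  perRectTrialState_liebPeriods_mem_emeryStates m _ _ _ _
    (fun k => by rw [trace_nAt_compl_mul_vacExtend (emeryPhysSites_subset m) (dummyPoint_mem_sdiff m k), Complex.zero_re])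
    (by rw [trace_totalNumber_mul_vacExtend, hN])

/-- **Cell energy of the views at `θ`** = `|block|⁻¹ · Re tr(H^θ_S ρ_S)`. [cite: Ruelle1969, §3.3] -/
theorem cellEnergy_emeryViews_emeryClusterTrialState (θ : Fin 14 → ℝ) :
    (emeryClusterTrialState m ρS hev hpsd htr).cellEnergy (emeryViews θ) 1 =
      (Fintype.card (Cell (alignedPeriods liebPeriods m)) : ℝ)⁻¹ *
        ((emeryInteraction θ).localHamiltonian (emeryPhysSites m) * ρS).trace.re := by
  rw [emeryClusterTrialState, cellEnergy_emeryViews_perRectTrialState,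
    (emeryInteraction θ).trace_localHamiltonian_mul_vacExtend (emeryPhysSites_subset m)
      (fun X hX hXS => emeryInteraction_apply_eq_zero_of_not_subset_phys m θ hX hXS)]

/-- **Cell energy of each direction** = `|block|⁻¹ · Re tr(D_{a,S} ρ_S)` (the fourteen conjugate densities of the trial state as cluster traces).
[cite: Ruelle1969, §3.3] -/
theorem cellEnergy_emeryDirections_emeryClusterTrialState (a : Fin 14) :
    (emeryClusterTrialState m ρS hev hpsd htr).cellEnergy (emeryDirections a) 1 =
      (Fintype.card (Cell (alignedPeriods liebPeriods m)) : ℝ)⁻¹ *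
        ((emeryAtoms a).localHamiltonian (emeryPhysSites m) * ρS).trace.re := by
  rw [emeryClusterTrialState, cellEnergy_emeryDirections_perRectTrialState,
    (emeryAtoms a).trace_localHamiltonian_mul_vacExtend (emeryPhysSites_subset m)
      (fun X hX hXS => emeryAtoms_apply_eq_zero_of_not_subset_phys m a hX hXS)]

/-- **The trial cap of the door, evaluated**: `e_{M(θ₀)}(ω̃) + Σ_a (θ_a − θ₀_a)·e_{D_a}(ω̃) = |block|⁻¹ Σ_a θ_a · Re tr(D_{a,S} ρ_S)` for every anchor `θ₀`
— an affine function of `θ` with fourteen cluster traces as slopes. [cite: KomaTasaki1994, §1] -/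
theorem trialCap_emeryClusterTrialState_eq (θ₀ θ : Fin 14 → ℝ) :
    (emeryClusterTrialState m ρS hev hpsd htr).cellEnergy (emeryViews θ₀) 1 +
        ∑ a, (θ a - θ₀ a) * (emeryClusterTrialState m ρS hev hpsd htr).cellEnergy (emeryDirections a) 1 =
      (Fintype.card (Cell (alignedPeriods liebPeriods m)) : ℝ)⁻¹ *
        ∑ a, θ a * ((emeryAtoms a).localHamiltonian (emeryPhysSites m) * ρS).trace.re := by
  rw [cellEnergy_emeryViews_emeryClusterTrialState, localHamiltonian_emeryInteraction, Finset.sum_mul, Matrix.trace_sum, Complex.re_sum]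
  simp only [cellEnergy_emeryDirections_emeryClusterTrialState, Matrix.smul_mul, Matrix.trace_smul, smul_eq_mul, Complex.re_ofReal_mul]
  rw [Finset.mul_sum, Finset.mul_sum, ← Finset.sum_add_distrib]
  refine Finset.sum_congr rfl fun a _ => ?_
  ring

/-- **THE CAP THROUGH THE STATE** (same inequality as `emeryEnergyDensity_le_physClusterTrace`, now by membership + cell energy — the shape the door uses).
[cite: Ruelle1969, §3.3] -/
theorem emeryEnergyDensity_le_cellEnergy_emeryClusterTrialState {ρ : ℝ}
    (hN : ((totalNumber : FermionOp (emeryPhysSites m)) * ρS).trace.re = 4 * Fintype.card (Cell m) * ρ) (θ : Fin 14 → ℝ) :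
    emeryEnergyDensity θ ρ ≤ (emeryClusterTrialState m ρS hev hpsd htr).cellEnergy (emeryViews θ) 1 :=
  infCellEnergyOn_le_cellEnergy _ 1 (emeryClusterTrialState_mem_emeryStates m ρS hev hpsd htr hN)

end TrialState

end InfVolFermionState

end Literature.MathematicalPhysics.QuantumLattice

end
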